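import Literature.IUT.LogVolume.CompletionLocalFields
import Literature.IUT.LogVolume.RescaledCompletionInvariants
import Mathlib.NumberTheory.NumberField.Discriminant.Different
import HarnessLib

/-!
# The genuine local fields `K_{v̲}` are absolutely unramified at the primes not dividing `disc(K)`
# (Dedekind's discriminant theorem, for the hypotheses of [IUTchIV] Thm. 1.10 Step (vi))

Record-only file (D-0012) of the abc-iut cell (Cor. 3.12 sub-crew, seat abc-iut-c312-3; plan/D9PRIME-OBLIGATIONS.md
row O3); classical, TAKES NO SIDE. Mochizuki, *Inter-universal Teichmüller theory IV* (RIMS ms Apr. 2020), proof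
of Thm. 1.10, Step (vi), kurims p. 29, treats the places `v ∉ 𝕍^dst` — odd residue characteristic, `K`
unramified at `v` — where "the “container of possible images” is precisely equal to the tensor product of
log-shells". The summand-level theorems of the cell for this step (`realPrimePacketM_shell_eq_O`,
`Summit.ABC.IUTFork.DHData.logμ_hullUTheta_ofIdelesM_eq_zero`, abc-iut-c312-d1's `hoff_ofTensor_of_sharp`) carry
the hypotheses "`2 < p`" and "`e(K_{v̲}/ℚ_p) = 1` for every `v | p`" (`absRamificationIdx p (K_{v̲}) = 1`). THIS
FILE discharges them for the GENUINE local fields of abc-iut-S2's `PlaceSection.localFields` (the rescaled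
completions `K_{v̲}` of abc-iut-S7) at every prime outside the prime factors of `2·|disc(K)|` (abc-iut-S2's
`ThetaVolumeInput.supportPrimes` minus `char(S)`):
* `absRamificationIdx_rescaledCompletion_eq_one_of_not_dvd_discr` — `p ∤ disc(K) ⇒ e(K_w/ℚ_p) = 1` for every
  `w | p` (abc-iut-S1's `absRamificationIdx_rescaledCompletion : e(K_w) = e(w|p)` + Mathlib's Dedekind
  discriminant theorem `NumberField.not_dvd_discr_iff_forall_mem` + `Ideal.ramificationIdx_eq_one_of_isUnramifiedAt`);
* `PlaceSection.absRamificationIdx_localFields_eq_one`, `…_localFieldFamily_eq_one` — the same for `K_{v̲}`,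
  `v̲ = σ.lift v` (the elementary bookkeeping "a prime outside `(2·|disc K|).primeFactors` is odd and does not divide
  `disc(K)`" is done summit-side, `Summits/ABC/IUTFork/LDHTensorHoffCompletions.lean`).
[cite: NeukirchANT1999, Ch. III Thm. (2.12)] [cite: Mochizuki2012, IUTchIV Thm 1.10 proof Step (vi) p.29]
Proof-only; no definitions; nothing here concerns [IUTchIII] Cor. 3.12.
-/

noncomputable section

namespace Literature.IUT.LogVolume

open NumberField IsDedekindDomain Literature.NumberTheory.NumberFields

/-- **`p ∤ disc(K) ⇒ K_w/ℚ_p` is unramified** for every place `w | p`: the norm-defined absolute ramification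
index of the rescaled completion is `1` (Dedekind: the primes dividing the discriminant are exactly the ramified
ones). [cite: NeukirchANT1999, Ch. III Thm. (2.12)] -/
theorem absRamificationIdx_rescaledCompletion_eq_one_of_not_dvd_discr (K : Type) [Field K] [NumberField K]
    (p : ℕ) [Fact p.Prime] (w : HeightOneSpectrum (𝓞 K)) (hw : ((p : ℕ) : 𝓞 K) ∈ w.asIdeal)
    (hdisc : ¬ (p : ℤ) ∣ NumberField.discr K) :
    absRamificationIdx p (RescaledCompletion K p w hw) = 1 := by
  rw [absRamificationIdx_rescaledCompletion K p w hw]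
  have hp : Prime (p : ℤ) := Nat.prime_iff_prime_int.mp Fact.out
  haveI : Algebra.IsUnramifiedAt ℤ w.asIdeal :=
    (NumberField.not_dvd_discr_iff_forall_mem K (𝓞 K) hp).mp hdisc w.asIdeal inferInstance
      (by exact_mod_cast hw)
  exact Ideal.ramificationIdx_eq_one_of_isUnramifiedAt

namespace PlaceSection

variable {F₀ K : Type} [Field F₀] [Field K] [Algebra F₀ K] [NumberField F₀] [NumberField K]
  (σ : PlaceSection F₀ K)

/-- **The genuine local field `K_{v̲}` is absolutely unramified when `p ∤ disc(K)`** (`v ∈ V(F₀)_p`,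
`v̲ = σ.lift v`). [cite: NeukirchANT1999, Ch. III Thm. (2.12)] -/
theorem absRamificationIdx_localFields_eq_one {p : ℕ} [Fact p.Prime] (hdisc : ¬ (p : ℤ) ∣ NumberField.discr K)
    (v : placesOver F₀ p) : absRamificationIdx p ((σ.localFields p).k v) = 1 :=
  absRamificationIdx_rescaledCompletion_eq_one_of_not_dvd_discr K p (σ.lift v.1) (σ.natCast_mem_lift v) hdisc

/-- The same for the member `σ.localFieldFamily p hp` of the local field family (the form consumed by
`DHData.ofIdelesM` / `hoff_ofIdelesM`). [cite: NeukirchANT1999, Ch. III Thm. (2.12)] -/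
theorem absRamificationIdx_localFieldFamily_eq_one {p : ℕ} [hp : Fact p.Prime]
    (hdisc : ¬ (p : ℤ) ∣ NumberField.discr K) (v : placesOver F₀ p) :
    absRamificationIdx p ((σ.localFieldFamily p hp.out).k v) = 1 :=
  σ.absRamificationIdx_localFields_eq_one hdisc v

end PlaceSection

end Literature.IUT.LogVolume

end
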